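import Summits.QuantumFields.YangMills.Theorems.UnitScaleTiltProp7TorusGreenSizeDecay
import Summits.QuantumFields.YangMills.Theorems.AllWindowsColdBoxTorusGreenGradientAllPoints

/-!
# Size decay of the torus Green function in four dimensions, uniform in the period ((J′1)/K1-T input: the size row)

The `d = 4` twin of the tree's `Prop7TorusGreenSizeDecay.torusGreen_mul_dist_le` (`d = 3`), by the same heat-kernel route: for the zero-mode-removed
Green function `G̃_L = torusGreen` of `(ℤ/Lℤ)⁴`,
* `abs_prod_torusHeatKernel_le_four_size` — `|∏_μ q^L_s(z_μ)| ≤ K·((s + z̃_{μ₀}²)²)⁻¹` for `0 < s ≤ L²` (four plain factors `(1∨s)^{−1/2}`, one Gaussian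
  weight kept);
* **`torusGreen_mul_dist_sq_le`** — `|G̃_L(z)|·dist(0,z)² ≤ C` for all `L ≥ 1`, `z ≠ 0` (heat-kernel part `K∫₀^{L²}(s+M²)⁻² ≤ K/M²`, zero mode `L⁻² ≤ (2M)⁻²`,
  Fourier tail `≤ (C₀⁴/8)L⁻²`, `dist ≤ 2M`): the lattice finite-volume form of `|x|⁻²`;
* **`torusGreen_size_le`** — all points, `L ≥ 2`: `|G̃_L(z)|·max(1, dist(0,z))² ≤ C` (at `z = 0`: `|G̃(0)| ≤ |G̃(e₀)| + 1` by `torusGreen_laplacian`).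
No definitions; standard axioms.  Reference: Lawler–Limic 2010, Thm. 4.3.1.

HONEST LABEL: helper toward the OPEN kernel stubs K1 (⟨stmt-QuantumFields-24006⟩) / S3b–U1 (⟨24004⟩, ⟨24336⟩); no stub, crux, rung or summit is proved here;
the Yang–Mills mass gap is NOT proved by this file.
-/

set_option autoImplicit false

noncomputable section

open MeasureTheory Set Finset ZMod intervalIntegral
open scoped Real BigOperators

namespace Summit.QuantumFields.YangMills.Theorems.AllWindowsColdBox.BoxKernel

open Literature.Probability.LatticeModels
open Summit.QuantumFields.YangMills.Theorems.Prop7TorusGreenGradientBricks (prod_le_apply_of_le_one' integral_inv_add_sq_le)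
open Summit.QuantumFields.YangMills.Theorems.Prop7TorusGreenSizeDecay (abs_torusGreen_tail_le rpow_neg_half_max_one_eq_inv_sqrt)

variable {L : ℕ}

/-- **Bound on the product heat kernel of `(ℤ/Lℤ)⁴` (size form)**: there is `K > 0` with `|∏_μ q^L_s(z_μ)| ≤ K·((s + z̃_{μ₀}²)²)⁻¹` for
`0 < s ≤ L²`, every `z` and every coordinate `μ₀` (`(1∨s)⁻²(1 + z̃²/(1∨s))⁻³ ≤ (1∨s)((1∨s)+z̃²)⁻³ ≤ ((1∨s)+z̃²)⁻² ≤ ((s+z̃²)²)⁻¹`). -/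
theorem abs_prod_torusHeatKernel_le_four_size : ∃ K : ℝ, 0 < K ∧ ∀ (L : ℕ) [NeZero L] (s : ℝ),
    0 < s → s ≤ (L : ℝ) ^ 2 → ∀ (z : TorusSite 4 L) (μ₀ : Fin 4),
      |∏ μ, torusHeatKernel s (z μ)| ≤ K * ((s + ((z μ₀).valMinAbs : ℝ) ^ 2) ^ 2)⁻¹ := by
  obtain ⟨K, hK, h₀⟩ := abs_torusHeatKernel_le
  refine ⟨K ^ 4, by positivity, ?_⟩
  intro L _ s hs hsL z μ₀
  set T : ℝ := max 1 s with hT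
  have hT1 : 1 ≤ T := le_max_left _ _
  have hT0 : 0 < T := by positivity
  have hsT : s ≤ T := le_max_right _ _
  set σ : ℝ := T ^ (-(1 / 2 : ℝ)) with hσ
  have hσ0 : 0 < σ := Real.rpow_pos_of_pos hT0 _
  have hσ' : σ = (Real.sqrt T)⁻¹ := rpow_neg_half_max_one_eq_inv_sqrt s
  have hsq : Real.sqrt T * Real.sqrt T = T := Real.mul_self_sqrt hT0.le
  have hsq0 : 0 < Real.sqrt T := Real.sqrt_pos.2 hT0
  set Mv : ℝ := ((z μ₀).valMinAbs : ℝ) with hMv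
  set W : Fin 4 → ℝ := fun μ => ((1 + ((z μ).valMinAbs : ℝ) ^ 2 / T) ^ 3)⁻¹ with hW
  have hW0 : ∀ μ, 0 ≤ W μ := fun μ => by positivity
  have hW1 : ∀ μ, W μ ≤ 1 := fun μ => by
    rw [hW]
    exact inv_le_one_of_one_le₀ (one_le_pow₀ (by
      have : 0 ≤ ((z μ).valMinAbs : ℝ) ^ 2 / T := by positivity
      linarith))
  have hWμ₀ : ∏ μ, W μ ≤ W μ₀ := prod_le_apply_of_le_one' hW0 hW1 μ₀
  have b₀ : ∀ m : ZMod L, |torusHeatKernel s m| ≤ K * σ * ((1 + (m.valMinAbs : ℝ) ^ 2 / T) ^ 3)⁻¹ := fun m => h₀ L s hs hsL m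
  -- `σ⁴ W_{μ₀} = T (T + M²)⁻³ ≤ ((s + M²)²)⁻¹`
  have hσ4 : σ ^ 4 = (T ^ 2)⁻¹ := by
    rw [hσ', inv_pow]
    congr 1
    nlinarith [hsq]
  have hWT : W μ₀ = T ^ 3 * ((T + Mv ^ 2) ^ 3)⁻¹ := by
    rw [hW, hMv]
    have hTne : T ≠ 0 := hT0.ne'
    field_simp
  have hkey : σ ^ 4 * W μ₀ ≤ ((s + Mv ^ 2) ^ 2)⁻¹ := by
    rw [hσ4, hWT]
    have hv0 : 0 < T + Mv ^ 2 := by positivity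
    have hu0 : 0 < s + Mv ^ 2 := by positivity
    calc (T ^ 2)⁻¹ * (T ^ 3 * ((T + Mv ^ 2) ^ 3)⁻¹) = T * ((T + Mv ^ 2) ^ 3)⁻¹ := by field_simp
      _ ≤ (T + Mv ^ 2) * ((T + Mv ^ 2) ^ 3)⁻¹ :=
          mul_le_mul_of_nonneg_right (by nlinarith) (by positivity)
      _ = ((T + Mv ^ 2) ^ 2)⁻¹ := by field_simp
      _ ≤ ((s + Mv ^ 2) ^ 2)⁻¹ := by
          apply inv_anti₀ (by positivity)
          exact pow_le_pow_left₀ hu0.le (by linarith) 2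
  rw [Finset.abs_prod]
  calc ∏ μ, |torusHeatKernel s (z μ)| ≤ ∏ μ, (K * σ * W μ) :=
        Finset.prod_le_prod (fun μ _ => abs_nonneg _) fun μ _ => b₀ (z μ)
    _ = K ^ 4 * σ ^ 4 * ∏ μ, W μ := by
        rw [Finset.prod_mul_distrib, Finset.prod_const, Finset.card_univ, Fintype.card_fin, mul_pow]
    _ ≤ K ^ 4 * σ ^ 4 * W μ₀ := by gcongr
    _ = K ^ 4 * (σ ^ 4 * W μ₀) := by ring
    _ ≤ K ^ 4 * ((s + Mv ^ 2) ^ 2)⁻¹ := mul_le_mul_of_nonneg_left hkey (by positivity)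

/-- **Size decay of the torus Green function in `d = 4`, uniformly in the period**: an absolute `C` with `|G̃_L(z)|·(Σ_μ z̃_μ²) ≤ C` for all
`L ≥ 1` and `z ≠ 0` in `(ℤ/Lℤ)⁴` (the lattice, finite-volume `|x|⁻²`). -/
theorem torusGreen_mul_dist_sq_le : ∃ C : ℝ, ∀ (L : ℕ) [NeZero L] (z : TorusSite 4 L), z ≠ 0 →
    |torusGreen z| * Real.sqrt (∑ k, (((z k).valMinAbs : ℤ) : ℝ) ^ 2) ^ 2 ≤ C := by
  obtain ⟨K, hK, hP⟩ := abs_prod_torusHeatKernel_le_four_size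
  set C₀ : ℝ := ∑' n : ℤ, (1 / 2 : ℝ) ^ n.natAbs with hC₀
  refine ⟨4 * (K + 1 / 4 + C₀ ^ 4 / 32), ?_⟩
  intro L _ z hz
  have hL : (0 : ℝ) < L := by exact_mod_cast Nat.pos_of_ne_zero (NeZero.ne L)
  -- the largest centred coordinate
  obtain ⟨μ₀, -, hμ₀⟩ := Finset.exists_max_image (univ : Finset (Fin 4)) (fun μ => (z μ).valMinAbs.natAbs) Finset.univ_nonempty
  set M : ℝ := |((z μ₀).valMinAbs : ℝ)| with hM
  have hMμ : ∀ μ, |((z μ).valMinAbs : ℝ)| ≤ M := fun μ => by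
    have h := hμ₀ μ (Finset.mem_univ μ)
    rw [hM, ← Int.cast_abs, ← Int.cast_abs, ← Int.natCast_natAbs, ← Int.natCast_natAbs]
    exact_mod_cast h
  have hM1 : 1 ≤ M := by
    obtain ⟨μ₁, hμ₁⟩ : ∃ μ, z μ ≠ 0 := by
      by_contra h
      push Not at h
      exact hz (funext h)
    have h1 : (z μ₁).valMinAbs ≠ 0 := fun h => hμ₁ ((ZMod.valMinAbs_eq_zero _).1 h)
    have h2 : (1 : ℝ) ≤ |((z μ₁).valMinAbs : ℝ)| := by
      rw [← Int.cast_abs]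
      exact_mod_cast Int.one_le_abs h1
    exact h2.trans (hMμ μ₁)
  have hM0 : 0 < M := by linarith
  have hML : 2 * M ≤ L := by
    have h := two_mul_abs_valMinAbs_le (z μ₀)
    rw [hM, ← Int.cast_abs]
    exact_mod_cast h
  -- the distance
  have hdist0 : 0 ≤ ∑ k, (((z k).valMinAbs : ℤ) : ℝ) ^ 2 := Finset.sum_nonneg fun k _ => sq_nonneg _
  have hdist : Real.sqrt (∑ k, (((z k).valMinAbs : ℤ) : ℝ) ^ 2) ^ 2 ≤ 4 * M ^ 2 := by
    rw [Real.sq_sqrt hdist0]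
    calc ∑ k, (((z k).valMinAbs : ℤ) : ℝ) ^ 2 ≤ ∑ _k : Fin 4, M ^ 2 :=
          Finset.sum_le_sum fun k _ => by
            rw [← sq_abs]
            exact pow_le_pow_left₀ (abs_nonneg _) (hMμ k) 2
      _ = 4 * M ^ 2 := by simp
  -- heat-kernel part, zero-mode term and tail at `S = L²`
  have hS : (0 : ℝ) ≤ (L : ℝ) ^ 2 := by positivity
  rw [torusGreen_eq_integral_add_tail z ((L : ℝ) ^ 2)]
  have hmain : |∫ s in (0 : ℝ)..(L : ℝ) ^ 2, (∏ i, torusHeatKernel s (z i) - ((L : ℝ) ^ 4)⁻¹)| ≤ K / M ^ 2 + 1 / (L : ℝ) ^ 2 := by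
    have hb : ∀ s ∈ Set.Ioc (0 : ℝ) ((L : ℝ) ^ 2),
        |∏ i, torusHeatKernel s (z i) - ((L : ℝ) ^ 4)⁻¹| ≤ K * ((s + M ^ 2) ^ 2)⁻¹ + ((L : ℝ) ^ 4)⁻¹ := by
      intro s hs
      refine (abs_sub _ _).trans (add_le_add ?_ (le_of_eq (abs_of_pos (by positivity))))
      have h := hP L s hs.1 hs.2 z μ₀
      have hc : ((z μ₀).valMinAbs : ℝ) ^ 2 = M ^ 2 := by rw [hM, sq_abs]
      rwa [hc] at h
    have hcont : IntervalIntegrable (fun s : ℝ => K * ((s + M ^ 2) ^ 2)⁻¹ + ((L : ℝ) ^ 4)⁻¹) volume 0 ((L : ℝ) ^ 2) := by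
      refine ContinuousOn.intervalIntegrable ?_
      rw [Set.uIcc_of_le hS]
      refine (continuousOn_const.mul (ContinuousOn.inv₀ ((continuousOn_id.add continuousOn_const).pow 2) fun s hs => ?_)).add
        continuousOn_const
      have h0 : 0 < s + M ^ 2 := by have := hs.1; positivity
      exact (pow_pos h0 2).ne'
    calc _ ≤ ∫ s in (0 : ℝ)..(L : ℝ) ^ 2, (K * ((s + M ^ 2) ^ 2)⁻¹ + ((L : ℝ) ^ 4)⁻¹) := by
          have h := intervalIntegral.norm_integral_le_of_norm_le hS
            (Filter.Eventually.of_forall fun s hs => (Real.norm_eq_abs _).le.trans (hb s hs)) hcont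
          rwa [Real.norm_eq_abs] at h
      _ = K * (∫ s in (0 : ℝ)..(L : ℝ) ^ 2, ((s + M ^ 2) ^ 2)⁻¹) + ((L : ℝ) ^ 2 - 0) * ((L : ℝ) ^ 4)⁻¹ := by
          rw [intervalIntegral.integral_add, intervalIntegral.integral_const_mul, intervalIntegral.integral_const, smul_eq_mul]
          · exact (ContinuousOn.intervalIntegrable (by
              rw [Set.uIcc_of_le hS]
              refine continuousOn_const.mul (ContinuousOn.inv₀ ((continuousOn_id.add continuousOn_const).pow 2) fun s hs => ?_)
              have h0 : 0 < s + M ^ 2 := by have := hs.1; positivity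
              exact (pow_pos h0 2).ne'))
          · exact intervalIntegrable_const
      _ ≤ K * (M ^ 2)⁻¹ + 1 / (L : ℝ) ^ 2 := by
          have h1 := integral_inv_add_sq_le (c := M ^ 2) (by positivity) hS
          have h2 : ((L : ℝ) ^ 2 - 0) * ((L : ℝ) ^ 4)⁻¹ = 1 / (L : ℝ) ^ 2 := by rw [sub_zero]; field_simp
          rw [h2]
          gcongr
      _ = K / M ^ 2 + 1 / (L : ℝ) ^ 2 := by ring
  have htail := abs_torusGreen_tail_le (d := 4) z
  rw [← hC₀] at htail
  -- `1/L² ≤ 1/(4M²)`, `L²/L⁴ = 1/L²`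
  have hL1 : 1 / (L : ℝ) ^ 2 ≤ 1 / (4 * M ^ 2) := by
    apply one_div_le_one_div_of_le (by positivity)
    nlinarith
  have hL3 : (L : ℝ) ^ 2 / 8 * C₀ ^ 4 / (L : ℝ) ^ 4 = C₀ ^ 4 / 8 * (1 / (L : ℝ) ^ 2) := by field_simp
  rw [hL3] at htail
  have hC₀0 : 0 ≤ C₀ := tsum_nonneg fun n => by positivity
  calc _ ≤ (K / M ^ 2 + 1 / (L : ℝ) ^ 2 + C₀ ^ 4 / 8 * (1 / (L : ℝ) ^ 2)) * (4 * M ^ 2) :=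
        mul_le_mul ((abs_add_le _ _).trans (add_le_add hmain htail)) hdist (pow_nonneg (Real.sqrt_nonneg _) _) (by positivity)
    _ ≤ (K / M ^ 2 + 1 / (4 * M ^ 2) + C₀ ^ 4 / 8 * (1 / (4 * M ^ 2))) * (4 * M ^ 2) := by gcongr
    _ = 4 * (K + 1 / 4 + C₀ ^ 4 / 32) := by
        field_simp
        ring

/-- **Size bound for the torus Green function, all points** (`d = 4`, `L ≥ 2`): an absolute `C` with `|G̃_L(z)|·max(1, dist(0,z))² ≤ C` for all `z`
(at the origin `|G̃(0)| ≤ |G̃(e₀)| + 1`). -/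
theorem torusGreen_size_le : ∃ C : ℝ, 0 ≤ C ∧ ∀ (L : ℕ) [NeZero L], 2 ≤ L → ∀ (z : TorusSite 4 L),
    |torusGreen z| * (max 1 (Real.sqrt (∑ k, (((z k).valMinAbs : ℤ) : ℝ) ^ 2))) ^ 2 ≤ C := by
  obtain ⟨C₀, hC₀⟩ := torusGreen_mul_dist_sq_le
  have hC₀0 : 0 ≤ C₀ := by
    haveI : NeZero (2 : ℕ) := ⟨by norm_num⟩
    have hz : (Pi.single (0 : Fin 4) (1 : ZMod 2) : TorusSite 4 2) ≠ 0 := by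
      intro h; have := congrFun h 0; simp at this
    exact le_trans (mul_nonneg (abs_nonneg _) (pow_nonneg (Real.sqrt_nonneg _) _)) (hC₀ 2 _ hz)
  refine ⟨C₀ + 1, by linarith, ?_⟩
  intro L _ hL z
  by_cases hz : z ≠ 0
  · rw [max_eq_right (one_le_sqrt_sum_valMinAbs_sq hz)]
    exact (hC₀ L z hz).trans (by linarith)
  · push Not at hz
    subst hz
    have hdist : Real.sqrt (∑ k, ((((0 : TorusSite 4 L) k).valMinAbs : ℤ) : ℝ) ^ 2) = 0 := by simp
    rw [hdist, max_eq_left zero_le_one, one_pow, mul_one]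
    -- `|G̃(0)| ≤ |G̃(e₀)| + 1`
    have he : (Pi.single (0 : Fin 4) (1 : ZMod L) : TorusSite 4 L) ≠ 0 := by
      intro h
      have h1 := congrFun h 0
      simp only [Pi.single_eq_same, Pi.zero_apply] at h1
      haveI : Fact (1 < L) := ⟨hL⟩
      exact one_ne_zero h1
    have h1 := hC₀ L _ he
    have hd1 := one_le_sqrt_sum_valMinAbs_sq he
    have hGe : |torusGreen (Pi.single (0 : Fin 4) (1 : ZMod L) : TorusSite 4 L)| ≤ C₀ := by
      calc |torusGreen (Pi.single (0 : Fin 4) (1 : ZMod L) : TorusSite 4 L)|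
            ≤ |torusGreen (Pi.single (0 : Fin 4) (1 : ZMod L) : TorusSite 4 L)| *
              Real.sqrt (∑ k, ((((Pi.single (0 : Fin 4) (1 : ZMod L) : TorusSite 4 L) k).valMinAbs : ℤ) : ℝ) ^ 2) ^ 2 :=
            le_mul_of_one_le_right (abs_nonneg _) (one_le_pow₀ hd1)
        _ ≤ C₀ := h1
    have hdiff := abs_torusGreen_single_sub_zero_le (d := 4) (L := L) 0
    rw [zero_add] at hdiff
    have := abs_sub_abs_le_abs_sub (torusGreen (0 : TorusSite 4 L)) (torusGreen (Pi.single (0 : Fin 4) (1 : ZMod L) : TorusSite 4 L))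
    rw [abs_sub_comm] at hdiff
    linarith

end Summit.QuantumFields.YangMills.Theorems.AllWindowsColdBox.BoxKernel

end
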